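import Literature.NumberTheory.DiophantineGeometry.FunctionFieldWronskian
import HarnessLib

/-!
# Corvaja–Zannier's gcd bound for `S`-units over function fields: the Wronskian argument
  (Corvaja–Zannier 2008, §2, Propositions 2.1–2.2)

Topic: `Literature/NumberTheory/DiophantineGeometry`. Sibling proof file towards the named fact
`Literature.NumberTheory.DiophantineGeometry.CorvajaZannier2008_cor23` (`FunctionFieldGCD.lean`), built on
`FunctionFieldDerivations` (`d/dt`) and `FunctionFieldWronskian` (Wronskians, change of variable, local
bounds, the Wronskian criterion).

P. Corvaja, U. Zannier, *Some cases of Vojta's conjecture on integral points over function fields*,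
J. Algebraic Geom. 17 (2008) 295–333 = arXiv:math/0512074, §2, pp. 4–6 of the arXiv text. We prove
**Propositions 2.1 and 2.2** in the following combined, integral form (`CorvajaZannier2008_prop22`): for
an algebraic function field `F/K` of characteristic `0` with all places rational and `K` the full constant
field, a finite set of places `S`, `a, b ∈ F ∖ K` with all zeros and poles in `S`, and integers `h, k ≥ 1`,
`n = hk + h + k`: **either** `[K(a,b) : K(a)] ≤ h` (the printed first alternative "`H(a) ≤ h·[κ(𝒞):κ(a,b)]`"
read on the curve with function field `κ(a,b)`, where `H(a) = [κ(a,b):κ(a)]`), **or**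

  `n · Σ_{v ∉ S} min{v(1-a), v(1-b)} ≤ (h + 2k)·H(b) + k·H(a) + (n(n-1)/2)·χ`,

`H(y) = [F : K(y)]` (number of poles), `χ = #S + 2g - 2` — the displayed inequality of Prop. 2.2
multiplied through by `hk + h + k`.

## Proof (as printed, pp. 4–6)

With `q = (1-a)/(1-b)` consider the `n` functions `f`: `aⁱq` (`i < k`) and `aʳbˢ` (`r ≤ k`, `s < h`)
(index set `Fin k ⊕ (Fin (k+1) × Fin h)`, transported to `Fin n`).
* `ω = 0` ⇒ first alternative (`linearIndependent_czFamily`): a `K`-relation, multiplied by `1 - b`, is a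
  `K(a)`-relation among `1, b, …, bʰ` whose coefficients must vanish if `[K(a)(b):K(a)] > h`; then all
  the polynomials in `a` vanish identically (`a` transcendental). Otherwise `ω = W_a(f) ≠ 0` by the Wronskian
  criterion, and `ω_v = W_{t_v}(f) = (da/dt_v)^{n(n-1)/2} ω` by (2.2), so `v(ω_v) = (n(n-1)/2) diffOrd_v(a) + v(ω)`.
* Cases (i)–(ii), `v ∉ S` (`mul_ord_le_ord_wronskian_uniformizer`): `v(ω_v) ≥ n·min(0, v(q))`, from
  `W(qg) = qⁿW(g)` with `g = (aⁱ; aʳbˢ/q)` integral at `v` when `v(q) ≤ 0` (this replaces the printed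
  column reduction of Case (i) and gives the same bound `n v(q)`), resp. `f` integral when `v(q) ≥ 0`.
* Case (iii), `v ∈ S`, `v(b) > 0`: by the identity (2.3) (`czIdentity`) the column operations
  `aⁱq ↦ aⁱq + Σ_s (aⁱ⁺¹bˢ - aⁱbˢ) = aⁱbʰq` (matrix `(1 0; N 1)`, determinant `1`, `wronskian_czFamily_eq`)
  and then `v(ω_v) ≥ Σ_x v(f'_x) - n(n-1)/2`; Case (iv), `v(b) ≤ 0`: the same bound for `f` itself.
  Uniformly: `v(ω_v) ≥ A v(a) + k v(q) + C v(b) + hk·max(0,v(b)) - n(n-1)/2` (`A, C` explicit sums).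
* Summing over a finite set of places `T ⊇ S` carrying all supports, with `Σ_v diffOrd_v(a) = 2g - 2`
  (Riemann–Hurwitz, `finsum_diffOrd_eq`), the product formula `Σ_v v(ω) = Σ_{v∈S} v(a) = Σ_{v∈S} v(b) = 0`
  and `Σ_{v∈S} max(0,v(b)) = H(b)`: (2.4)–(2.5)
  `(n(n-1)/2)(2g-2) ≥ k Σ_{v∈S} v(q) + hk H(b) - (n(n-1)/2) #S + n Σ_{v∉S} min(0,v(q))`,
  then `-Σ_{v∈S} v(q) ≤ H(q) ≤ H(a) + H(b)` and, for Prop. 2.2,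
  `H_S(q) = Σ_{v∉S} (v(1-b) - min{v(1-a),v(1-b)}) ≤ H(b) - Σ_{v∉S} min{v(1-a),v(1-b)}`.

Everything is proved; no named facts are introduced.

## References

* P. Corvaja, U. Zannier, J. Algebraic Geom. 17 (2008) 295–333, §2, Prop. 2.1, Prop. 2.2, (2.2)–(2.5).
  [CorvajaZannier2007]
* H. Stichtenoth, *Algebraic Function Fields and Codes*, GTM 254 (2009), Thm. 1.4.11, Cor. 3.4.14.
  [Stichtenoth2009]
-/

noncomputable section


open scoped Classical IntermediateField
open Polynomial Finset Matrix

namespace Literature.NumberTheory.DiophantineGeometry.AlgFunctionField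

universe u v

variable {K : Type u} {F : Type v} [Field K] [Field F] [Algebra K F]

/-! ### The Corvaja–Zannier family `f` and its linear independence (the case `ω = 0`) -/

section family

/-- Coefficients of a polynomial `Σ_{i : Fin m} C(c i) X^i`. [folklore] -/
theorem coeff_sum_C_mul_X_pow {m : ℕ} (c : Fin m → K) (i : Fin m) :
    (∑ j : Fin m, C (c j) * X ^ (j : ℕ)).coeff i = c i := by
  rw [finsetSum_coeff, Finset.sum_eq_single i]
  · rw [coeff_C_mul_X_pow, if_pos rfl]
  · intro j _ hji
    rw [coeff_C_mul_X_pow, if_neg (fun h ↦ hji (Fin.ext h.symm))]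
  · intro h; exact absurd (Finset.mem_univ i) h

/-- A polynomial `Σ_{i : Fin m} C(c i) X^i` vanishing identically has zero coefficients. [folklore] -/
theorem eq_zero_of_sum_C_mul_X_pow_eq_zero {m : ℕ} {c : Fin m → K}
    (h : ∑ j : Fin m, C (c j) * X ^ (j : ℕ) = 0) (i : Fin m) : c i = 0 := by
  rw [← coeff_sum_C_mul_X_pow c i, h, coeff_zero]

/-- Evaluation of `Σ_{i : Fin m} C(c i) X^i`. [folklore] -/
theorem aeval_sum_C_mul_X_pow {A : Type*} [CommRing A] [Algebra K A] {m : ℕ} (c : Fin m → K) (x : A) :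
    aeval x (∑ j : Fin m, C (c j) * X ^ (j : ℕ)) = ∑ j : Fin m, c j • x ^ (j : ℕ) := by
  rw [map_sum]
  refine Finset.sum_congr rfl fun j _ ↦ ?_
  rw [map_mul, aeval_C, map_pow, aeval_X, Algebra.smul_def]

/-- **Linear independence of the Corvaja–Zannier family** (the case `ω = 0` of the proof of
Prop. 2.1). Let `a ∈ F` be transcendental over `K`, `q (1 - b) = 1 - a`, and suppose
`1, b, …, b^h` are linearly independent over `K(a)` (i.e. `[K(a, b) : K(a)] > h`). Then the
`hk + h + k` functions `aⁱ q` (`i < k`) and `aʳ bˢ` (`r ≤ k`, `s < h`) are linearly independent over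
`K`: a relation, multiplied by `1 - b`, reads `P₁(a)(1 - a) + Σ_s P₂,ₛ(a)(bˢ - bˢ⁺¹) = 0`, a
`K(a)`-linear relation among `1, b, …, b^h`, whose coefficients `-P₂,ₕ₋₁(a)`,
`P₂,ₛ(a) - P₂,ₛ₋₁(a)`, `P₁(a)(1 - a) + P₂,₀(a)` therefore vanish; hence all `P₂,ₛ = 0` and `P₁ = 0`
as polynomials (`a` transcendental). [cite: CorvajaZannier2007, §2 (proof of Prop. 2.1, "Suppose first that ω = 0")] -/
theorem linearIndependent_czFamily {a b q : F} (ha : Transcendental K a) (hqb : q * (1 - b) = 1 - a)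
    {h k : ℕ} (hh : 0 < h)
    (hpow : LinearIndependent K⟮a⟯ fun s : Fin (h + 1) ↦ b ^ (s : ℕ)) :
    LinearIndependent K (Sum.elim (fun i : Fin k ↦ a ^ (i : ℕ) * q)
      (fun rs : Fin (k + 1) × Fin h ↦ a ^ (rs.1 : ℕ) * b ^ (rs.2 : ℕ))) := by
  rw [Fintype.linearIndependent_iff]
  intro c hc
  set L := K⟮a⟯ with hL
  set α : L := IntermediateField.AdjoinSimple.gen K a with hα
  have hαa : algebraMap L F α = a := IntermediateField.AdjoinSimple.algebraMap_gen K a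
  -- the polynomials `P₁`, `P₂,ₛ`
  set c₂ : Fin (k + 1) → ℕ → K := fun r s ↦ if hs : s < h then c (Sum.inr (r, ⟨s, hs⟩)) else 0 with hc₂
  set p₁ : K[X] := ∑ i : Fin k, C (c (Sum.inl i)) * X ^ (i : ℕ) with hp₁
  set p₂ : ℕ → K[X] := fun s ↦ ∑ r : Fin (k + 1), C (c₂ r s) * X ^ (r : ℕ) with hp₂
  have hp₁a : aeval a p₁ = ∑ i : Fin k, c (Sum.inl i) • a ^ (i : ℕ) := aeval_sum_C_mul_X_pow _ a
  have hp₂a : ∀ s, aeval a (p₂ s) = ∑ r : Fin (k + 1), c₂ r s • a ^ (r : ℕ) := fun s ↦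
    aeval_sum_C_mul_X_pow _ a
  -- the relation, rewritten: `q P₁(a) + Σ_{s<h} P₂,ₛ(a) bˢ = 0`
  have hrel : q * aeval a p₁ + ∑ s ∈ range h, aeval a (p₂ s) * b ^ s = 0 := by
    rw [← hc, Fintype.sum_sum_type, Fintype.sum_prod_type]
    simp only [Sum.elim_inl, Sum.elim_inr]
    congr 1
    · rw [hp₁a, Finset.mul_sum]
      exact Finset.sum_congr rfl fun i _ ↦ by rw [mul_smul_comm, mul_comm]
    · rw [Finset.sum_comm]
      rw [← Fin.sum_univ_eq_sum_range (fun s ↦ aeval a (p₂ s) * b ^ s) h]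
      refine Finset.sum_congr rfl fun s _ ↦ ?_
      rw [hp₂a, Finset.sum_mul]
      refine Finset.sum_congr rfl fun r _ ↦ ?_
      simp only [hc₂, dif_pos s.2, Fin.eta, smul_mul_assoc]
  -- multiplied by `1 - b`: `(1 - a) P₁(a) + Σ_{s<h} P₂,ₛ(a) (bˢ - bˢ⁺¹) = 0`
  have hrel' : (1 - a) * aeval a p₁ + ∑ s ∈ range h, aeval a (p₂ s) * (b ^ s - b ^ (s + 1)) = 0 := by
    have := congrArg (· * (1 - b)) hrel
    simp only [zero_mul, add_mul, Finset.sum_mul] at this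
    rw [← this, mul_right_comm, hqb]
    congr 1
    exact Finset.sum_congr rfl fun s _ ↦ by ring
  -- the `K(a)`-coefficients of `1, b, …, b^h`
  set P₂ : ℕ → L := fun s ↦ aeval α (p₂ s) with hP₂
  set P₁ : L := aeval α p₁ with hP₁
  have hP₂F : ∀ s, algebraMap L F (P₂ s) = aeval a (p₂ s) := fun s ↦ by
    rw [hP₂, ← aeval_algebraMap_apply, hαa]
  have hP₁F : algebraMap L F P₁ = aeval a p₁ := by rw [hP₁, ← aeval_algebraMap_apply, hαa]
  set d : ℕ → L := fun s ↦ (if s = 0 then (1 - α) * P₁ else 0) + (if s < h then P₂ s else 0) -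
    (if 0 < s then P₂ (s - 1) else 0) with hd
  have hdF : ∀ s, algebraMap L F (d s) = (if s = 0 then (1 - a) * aeval a p₁ else 0) +
      (if s < h then aeval a (p₂ s) else 0) - (if 0 < s then aeval a (p₂ (s - 1)) else 0) := by
    intro s
    simp only [hd, map_add, map_sub]
    congr 2
    · split_ifs
      · rw [map_mul, map_sub, map_one, hαa, hP₁F]
      · rw [map_zero]
    · split_ifs
      · exact hP₂F s
      · rw [map_zero]
    · split_ifs
      · exact hP₂F _
      · rw [map_zero]
  have hdsum : ∑ s : Fin (h + 1), d s • b ^ (s : ℕ) = 0 := by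
    rw [Fin.sum_univ_eq_sum_range (fun s ↦ d s • b ^ s) (h + 1)]
    set A := (1 - a) * aeval a p₁ with hA
    simp only [Algebra.smul_def, hdF, add_mul, sub_mul, ite_mul, zero_mul, Finset.sum_add_distrib,
      Finset.sum_sub_distrib, Finset.sum_ite_eq', Finset.mem_range, Nat.succ_pos, if_true, pow_zero,
      mul_one]
    -- the middle sum: restrict to `s < h`
    have h2 : ∑ s ∈ range (h + 1), (if s < h then aeval a (p₂ s) * b ^ s else 0) =
        ∑ s ∈ range h, aeval a (p₂ s) * b ^ s := by
      rw [Finset.sum_range_succ, if_neg (lt_irrefl h), add_zero]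
      exact Finset.sum_congr rfl fun s hs ↦ if_pos (Finset.mem_range.1 hs)
    -- the last sum: shift
    have h3 : ∑ s ∈ range (h + 1), (if 0 < s then aeval a (p₂ (s - 1)) * b ^ s else 0) =
        ∑ s ∈ range h, aeval a (p₂ s) * b ^ (s + 1) := by
      rw [Finset.sum_range_succ']
      simp
    rw [h2, h3, ← hrel', hA, add_sub_assoc, ← Finset.sum_sub_distrib]
    congr 1
    exact Finset.sum_congr rfl fun s _ ↦ by ring
  have hd0 : ∀ s, s < h + 1 → d s = 0 := fun s hs ↦
    Fintype.linearIndependent_iff.1 hpow (fun s ↦ d s) hdsum ⟨s, hs⟩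
  -- downward induction: all `P₂,ₛ = 0`
  have hP₂top : P₂ (h - 1) = 0 := by
    have := hd0 h (Nat.lt_succ_self h)
    simp only [hd, if_neg (Nat.pos_iff_ne_zero.1 hh), lt_irrefl, if_false, if_pos hh, zero_add,
      zero_sub, neg_eq_zero] at this
    exact this
  have hP₂zero : ∀ j, j < h → P₂ (h - 1 - j) = 0 := by
    intro j
    induction j with
    | zero => intro _; simpa using hP₂top
    | succ j ih =>
      intro hj
      have hs : 0 < h - 1 - j := by omega
      have := hd0 (h - 1 - j) (by omega)
      simp only [hd, if_neg (Nat.pos_iff_ne_zero.1 hs), if_pos (show h - 1 - j < h by omega), if_pos hs,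
        zero_add, sub_eq_zero] at this
      rw [ih (by omega)] at this
      rw [show h - 1 - (j + 1) = h - 1 - j - 1 by omega]
      exact this.symm
  have hP₂all : ∀ s, s < h → P₂ s = 0 := fun s hs ↦ by
    have := hP₂zero (h - 1 - s) (by omega)
    rwa [show h - 1 - (h - 1 - s) = s by omega] at this
  have hP₁zero : P₁ = 0 := by
    have := hd0 0 (Nat.succ_pos h)
    simp only [hd, if_pos hh, lt_irrefl, if_false, sub_zero, hP₂all 0 hh, add_zero] at this
    refine (mul_eq_zero.1 this).resolve_left fun h1 ↦ ?_
    apply ha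
    have : a = algebraMap K F 1 := by
      have h1' := congrArg (algebraMap L F) h1
      rw [map_sub, map_one, hαa, map_zero, sub_eq_zero] at h1'
      rw [map_one]; exact h1'.symm
    rw [this]; exact isAlgebraic_algebraMap 1
  -- transcendence of `a`: the polynomials vanish
  have hvan : ∀ p : K[X], aeval α p = 0 → p = 0 := fun p hp ↦ by
    by_contra hne
    apply ha
    refine ⟨p, hne, ?_⟩
    rw [← hαa, aeval_algebraMap_apply, hp, map_zero]
  have hp₁zero : p₁ = 0 := hvan p₁ hP₁zero
  have hp₂zero : ∀ s, s < h → p₂ s = 0 := fun s hs ↦ hvan _ (hP₂all s hs)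
  rintro (i | ⟨r, s⟩)
  · exact eq_zero_of_sum_C_mul_X_pow_eq_zero hp₁zero i
  · have := eq_zero_of_sum_C_mul_X_pow_eq_zero (hp₂zero s s.2) r
    simpa [hc₂, dif_pos s.2] using this

end family


/-! ### Local estimates for the Wronskians `ω_v` (Corvaja–Zannier, proof of Prop. 2.1, Cases (i)–(iv)) -/

section local_estimates

variable [IsAlgFunctionField K F] [IsIntegrallyClosedIn K F] [CharZero K]

/-- **Cases (i)–(ii)** (places outside `S`): if `q ≠ 0` and every `q⁻¹ f_j` is integral at `P`, then
`v_P(W_{t_P}(f)) ≥ n · v_P(q)` (`W(q g) = qⁿ W(g)` and `W_{t_P}(g)` is integral).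
[cite: CorvajaZannier2007, §2 (proof of Prop. 2.1, Cases (i)–(ii))] -/
theorem mul_ord_le_ord_wronskian_uniformizer (hrat : ∀ P : PlaceOver K F, P.IsRational)
    (P : PlaceOver K F) {n : ℕ} {f : Fin n → F} {q : F} (hq : q ≠ 0)
    (hf : ∀ j, q⁻¹ * f j ∈ P.toValuationSubring) (hW : wronskian K (P.uniformizer : F) f ≠ 0) :
    (n : ℤ) * P.ord q ≤ P.ord (wronskian K (P.uniformizer : F) f) := by
  set g : Fin n → F := fun j ↦ q⁻¹ * f j with hg
  have hfg : f = fun j ↦ q * g j := funext fun j ↦ by rw [hg, mul_inv_cancel_left₀ hq]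
  have hWg : wronskian K (P.uniformizer : F) f = q ^ n * wronskian K (P.uniformizer : F) g := by
    rw [hfg, wronskian_mul _ hq]
  have hgmem := wronskian_uniformizer_mem hrat P (g := g) hf
  have hg0 : wronskian K (P.uniformizer : F) g ≠ 0 := fun h0 ↦ hW (by rw [hWg, h0, mul_zero])
  rw [hWg, P.ord_mul_eq (pow_ne_zero _ hq) hg0, P.ord_pow hq]
  have := P.ord_nonneg_of_mem hgmem
  linarith

/-- The index type of the Corvaja–Zannier family: `k` functions `aⁱ q` and `(k+1)h` monomials `aʳ bˢ`;
its cardinality is `n = hk + h + k`. [cite: CorvajaZannier2007, §2 (proof of Prop. 2.1)] -/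
theorem card_czIndex (h k : ℕ) : Fintype.card (Fin k ⊕ (Fin (k + 1) × Fin h)) = h * k + h + k := by
  simp only [Fintype.card_sum, Fintype.card_prod, Fintype.card_fin]
  ring

omit [IsAlgFunctionField K F] [IsIntegrallyClosedIn K F] [CharZero K] in
/-- Orders of the members of the family: `Σ_x v(f_x) = A v(a) + k v(q) + C v(b)` with
`A = Σ_i i + Σ_{r,s} r`, `C = Σ_{r,s} s`, for the family with `f_{inl i} = aⁱ bᵐ q`, `f_{inr (r,s)} = aʳ bˢ`
(`m = 0` for the original family, `m = h` after the column operations of Case (iii)).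
[cite: CorvajaZannier2007, §2 (proof of Prop. 2.1, Cases (iii)–(iv))] -/
theorem sum_ord_czFamily (P : PlaceOver K F) {a b q : F} (ha : a ≠ 0) (hb : b ≠ 0) (hq : q ≠ 0)
    (h k m : ℕ) :
    ∑ x : Fin k ⊕ (Fin (k + 1) × Fin h),
        P.ord (Sum.elim (fun i : Fin k ↦ a ^ (i : ℕ) * b ^ m * q)
          (fun rs : Fin (k + 1) × Fin h ↦ a ^ (rs.1 : ℕ) * b ^ (rs.2 : ℕ)) x) =
      (∑ i : Fin k, (i : ℤ) + ∑ rs : Fin (k + 1) × Fin h, (rs.1 : ℤ)) * P.ord a + k * P.ord q +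
        (∑ rs : Fin (k + 1) × Fin h, (rs.2 : ℤ)) * P.ord b + k * m * P.ord b := by
  rw [Fintype.sum_sum_type]
  simp only [Sum.elim_inl, Sum.elim_inr]
  have h1 : ∀ i : Fin k, P.ord (a ^ (i : ℕ) * b ^ m * q) = (i : ℤ) * P.ord a + m * P.ord b + P.ord q := by
    intro i
    rw [P.ord_mul_eq (mul_ne_zero (pow_ne_zero _ ha) (pow_ne_zero _ hb)) hq,
      P.ord_mul_eq (pow_ne_zero _ ha) (pow_ne_zero _ hb), P.ord_pow ha, P.ord_pow hb]
  have h2 : ∀ rs : Fin (k + 1) × Fin h, P.ord (a ^ (rs.1 : ℕ) * b ^ (rs.2 : ℕ)) =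
      (rs.1 : ℤ) * P.ord a + (rs.2 : ℤ) * P.ord b := by
    intro rs
    rw [P.ord_mul_eq (pow_ne_zero _ ha) (pow_ne_zero _ hb), P.ord_pow ha, P.ord_pow hb]
  simp only [h1, h2, Finset.sum_add_distrib, ← Finset.sum_mul, Finset.sum_const, Finset.card_univ,
    Fintype.card_fin]
  ring

/-- **Cases (iii)–(iv)** (places of `S`), the general bound: `v_P(ω_P) ≥ Σ_x v_P(f_x) - n(n-1)/2`, with
the family written on its natural index set. [cite: CorvajaZannier2007, §2 (proof of Prop. 2.1, Case (iv))] -/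
theorem sum_ord_sub_le_ord_wronskian_uniformizer_equiv (hrat : ∀ P : PlaceOver K F, P.IsRational)
    (P : PlaceOver K F) {ι : Type*} [Fintype ι] {n : ℕ} (e : ι ≃ Fin n) {f : ι → F} (hf : ∀ x, f x ≠ 0)
    (hW : wronskian K (P.uniformizer : F) (f ∘ e.symm) ≠ 0) :
    ∑ x, P.ord (f x) - (n * (n - 1) / 2 : ℕ) ≤ P.ord (wronskian K (P.uniformizer : F) (f ∘ e.symm)) := by
  have h := sum_ord_sub_le_ord_wronskian_uniformizer hrat P (g := f ∘ e.symm) (fun j ↦ hf _) hW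
  rwa [show ∑ j : Fin n, P.ord ((f ∘ e.symm) j) = ∑ x, P.ord (f x) from
    Equiv.sum_comp e.symm (fun x ↦ P.ord (f x))] at h

omit [IsAlgFunctionField K F] [IsIntegrallyClosedIn K F] [CharZero K] in
/-- **The identity (2.3)** as a column operation: with `q (1 - b) = 1 - a`,
`aⁱ q + Σ_{s<h} (aⁱ⁺¹ bˢ - aⁱ bˢ) = aⁱ bʰ q`. [cite: CorvajaZannier2007, §2 (2.3)] -/
theorem czIdentity {a b q : F} (hqb : q * (1 - b) = 1 - a) (i h : ℕ) :
    a ^ i * q + ∑ s ∈ range h, (a ^ (i + 1) * b ^ s - a ^ i * b ^ s) = a ^ i * b ^ h * q := by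
  have hgeom := mul_neg_geom_sum b h
  have : ∑ s ∈ range h, (a ^ (i + 1) * b ^ s - a ^ i * b ^ s) = -(a ^ i * (1 - a) * ∑ s ∈ range h, b ^ s) := by
    rw [Finset.mul_sum, ← Finset.sum_neg_distrib]
    exact Finset.sum_congr rfl fun s _ ↦ by ring
  rw [this, ← hqb]
  linear_combination (-(a ^ i * q)) * hgeom

omit [IsAlgFunctionField K F] [IsIntegrallyClosedIn K F] [CharZero K] in
/-- The column-operation matrix of Case (iii): `M = (1 0; N 1)` on `Fin k ⊕ (Fin (k+1) × Fin h)` with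
`N_{(r,s), i} = [r = i+1] - [r = i]`; `det M = 1`. [cite: CorvajaZannier2007, §2 (proof of Prop. 2.1, Case (iii))] -/
theorem det_czMatrix (h k : ℕ) :
    (Matrix.fromBlocks (1 : Matrix (Fin k) (Fin k) K) 0
      (Matrix.of fun (rs : Fin (k + 1) × Fin h) (i : Fin k) ↦
        ((if rs.1 = i.succ then 1 else 0) - (if rs.1 = i.castSucc then 1 else 0) : K))
      (1 : Matrix (Fin (k + 1) × Fin h) (Fin (k + 1) × Fin h) K)).det = 1 := by
  rw [Matrix.det_fromBlocks_zero₁₂, det_one, det_one, mul_one]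

omit [IsAlgFunctionField K F] [IsIntegrallyClosedIn K F] [CharZero K] in
/-- The column operations of Case (iii) transform the family `(aⁱ q; aʳ bˢ)` into `(aⁱ bʰ q; aʳ bˢ)`.
[cite: CorvajaZannier2007, §2 (proof of Prop. 2.1, Case (iii))] -/
theorem czFamily_linComb {a b q : F} (hqb : q * (1 - b) = 1 - a) (h k : ℕ) :
    (fun y : Fin k ⊕ (Fin (k + 1) × Fin h) ↦ ∑ x,
      (Matrix.fromBlocks (1 : Matrix (Fin k) (Fin k) K) 0
        (Matrix.of fun (rs : Fin (k + 1) × Fin h) (i : Fin k) ↦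
          ((if rs.1 = i.succ then 1 else 0) - (if rs.1 = i.castSucc then 1 else 0) : K))
        (1 : Matrix (Fin (k + 1) × Fin h) (Fin (k + 1) × Fin h) K)) x y •
      Sum.elim (fun i : Fin k ↦ a ^ (i : ℕ) * q)
        (fun rs : Fin (k + 1) × Fin h ↦ a ^ (rs.1 : ℕ) * b ^ (rs.2 : ℕ)) x) =
    Sum.elim (fun i : Fin k ↦ a ^ (i : ℕ) * b ^ h * q)
      (fun rs : Fin (k + 1) × Fin h ↦ a ^ (rs.1 : ℕ) * b ^ (rs.2 : ℕ)) := by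
  funext y
  rw [Fintype.sum_sum_type]
  rcases y with i | ⟨r, s⟩
  · simp only [Matrix.fromBlocks_apply₁₁, Matrix.fromBlocks_apply₂₁, Matrix.one_apply, Matrix.of_apply,
      Sum.elim_inl, Sum.elim_inr, ite_smul, one_smul, zero_smul, Finset.sum_ite_eq', Finset.mem_univ,
      if_true, sub_smul]
    rw [Finset.sum_sub_distrib, Fintype.sum_prod_type, Fintype.sum_prod_type]
    simp only [Finset.sum_ite_irrel, Finset.sum_const_zero, Finset.sum_ite_eq', Finset.mem_univ, if_true,
      Fin.val_succ, Fin.val_castSucc]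
    rw [← Finset.sum_sub_distrib, Fin.sum_univ_eq_sum_range (fun s ↦ a ^ ((i : ℕ) + 1) * b ^ s - a ^ (i : ℕ) * b ^ s) h]
    exact czIdentity hqb i h
  · simp only [Matrix.fromBlocks_apply₁₂, Matrix.fromBlocks_apply₂₂, Matrix.zero_apply, Matrix.one_apply,
      Sum.elim_inl, Sum.elim_inr, zero_smul, Finset.sum_const_zero, zero_add, ite_smul, one_smul,
      Finset.sum_ite_eq', Finset.mem_univ, if_true]

omit [CharZero K] in
/-- **Case (iii)** as a Wronskian identity: the local Wronskian of the family `(aⁱ q; aʳ bˢ)` equals that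
of `(aⁱ bʰ q; aʳ bˢ)` (column operations of determinant `1`).
[cite: CorvajaZannier2007, §2 (proof of Prop. 2.1, Case (iii))] -/
theorem wronskian_czFamily_eq (t : F) {a b q : F} (hqb : q * (1 - b) = 1 - a) (h k : ℕ) {n : ℕ}
    (e : (Fin k ⊕ (Fin (k + 1) × Fin h)) ≃ Fin n) :
    wronskian K t (Sum.elim (fun i : Fin k ↦ a ^ (i : ℕ) * b ^ h * q)
        (fun rs : Fin (k + 1) × Fin h ↦ a ^ (rs.1 : ℕ) * b ^ (rs.2 : ℕ)) ∘ e.symm) =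
      wronskian K t (Sum.elim (fun i : Fin k ↦ a ^ (i : ℕ) * q)
        (fun rs : Fin (k + 1) × Fin h ↦ a ^ (rs.1 : ℕ) * b ^ (rs.2 : ℕ)) ∘ e.symm) := by
  rw [← czFamily_linComb (K := K) hqb h k, wronskian_linComb_equiv, det_czMatrix, map_one, mul_one]

end local_estimates


/-! ### Heights as numbers of poles and zeros -/

section heights

variable [IsAlgFunctionField K F]

/-- Off the support of its divisor, a function has order `0`. [folklore] -/
theorem PlaceOver.ord_eq_zero_of_not_mem_support {y : F} (hy : y ≠ 0) {v : PlaceOver K F}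
    (hv : v ∉ (principalDivisor K y).support) : v.ord y = 0 := by
  rwa [Finsupp.mem_support_iff, principalDivisor_apply_of_ne_zero hy, not_not] at hv

/-- **Product formula**: `Σ_v v(y) = 0` for `y ≠ 0` (all places rational: `deg (y) = 0`).
[cite: Stichtenoth2009, Thm. 1.4.11] -/
theorem finsum_ord_eq_zero (hrat : ∀ P : PlaceOver K F, P.IsRational) {y : F} (hy : y ≠ 0) :
    ∑ᶠ v : PlaceOver K F, v.ord y = 0 := by
  rw [← degree_principalDivisor_eq_zero (K := K) hy, Divisor.degree_eq_finsum hrat]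
  exact finsum_congr fun v ↦ (principalDivisor_apply_of_ne_zero hy v).symm

variable [IsIntegrallyClosedIn K F]

/-- **The height as the number of poles**: `Σ_v max(0, -v(y)) = [F : K(y)]` for `y ∉ K` (all places
rational). [cite: Stichtenoth2009, Thm. 1.4.11] -/
theorem finsum_max_neg_ord_eq_finrank (hrat : ∀ P : PlaceOver K F, P.IsRational) {y : F}
    (hy : y ∉ Set.range (algebraMap K F)) :
    ∑ᶠ v : PlaceOver K F, max 0 (-v.ord y) = (Module.finrank K⟮y⟯ F : ℤ) := by
  have hy0 : y ≠ 0 := fun h ↦ hy ⟨0, by rw [h, map_zero]⟩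
  set U : Finset (PlaceOver K F) := (principalDivisor K y).support.filter fun v ↦ v.ord y < 0 with hU
  have hUmem : ∀ v, v ∈ U ↔ v.ord y < 0 := fun v ↦ by
    rw [hU, Finset.mem_filter, Finsupp.mem_support_iff, principalDivisor_apply_of_ne_zero hy0]
    exact ⟨fun h ↦ h.2, fun h ↦ ⟨h.ne, h⟩⟩
  rw [← sum_neg_ord_eq_finrank hrat hy U (fun v hv ↦ (hUmem v).1 hv) (fun v hv ↦ (hUmem v).2 hv),
    finsum_eq_sum_of_support_subset _ (s := U)]
  · exact Finset.sum_congr rfl fun v hv ↦ max_eq_right (by have := (hUmem v).1 hv; omega)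
  · intro v hv
    rw [Function.mem_support] at hv
    exact Finset.mem_coe.2 ((hUmem v).2 (by by_contra h; exact hv (max_eq_left (by omega))))

/-- **The height as the number of zeros of `y - c`**: `Σ_v max(0, v(y - c)) = [F : K(y)]` for `y ∉ K`.
[cite: Stichtenoth2009, Thm. 1.4.11] -/
theorem finsum_max_ord_sub_eq_finrank (hrat : ∀ P : PlaceOver K F, P.IsRational) {y : F}
    (hy : y ∉ Set.range (algebraMap K F)) (c : K) :
    ∑ᶠ v : PlaceOver K F, max 0 (v.ord (y - algebraMap K F c)) = (Module.finrank K⟮y⟯ F : ℤ) := by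
  have hyc : y - algebraMap K F c ≠ 0 := fun h ↦ hy ⟨c, (sub_eq_zero.1 h).symm⟩
  set U : Finset (PlaceOver K F) :=
    (principalDivisor K (y - algebraMap K F c)).support.filter fun v ↦ 0 < v.ord (y - algebraMap K F c) with hU
  have hUmem : ∀ v, v ∈ U ↔ 0 < v.ord (y - algebraMap K F c) := fun v ↦ by
    rw [hU, Finset.mem_filter, Finsupp.mem_support_iff, principalDivisor_apply_of_ne_zero hyc]
    exact ⟨fun h ↦ h.2, fun h ↦ ⟨h.ne', h⟩⟩
  rw [← sum_ord_sub_eq_finrank hrat hy c U (fun v hv ↦ (hUmem v).1 hv) (fun v hv ↦ (hUmem v).2 hv),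
    finsum_eq_sum_of_support_subset _ (s := U)]
  · exact Finset.sum_congr rfl fun v hv ↦ max_eq_right (by have := (hUmem v).1 hv; omega)
  · intro v hv
    rw [Function.mem_support] at hv
    exact Finset.mem_coe.2 ((hUmem v).2 (by by_contra h; exact hv (max_eq_left (by omega))))

omit [IsAlgFunctionField K F] [IsIntegrallyClosedIn K F] in
/-- Poles of `1 - a` are the poles of `a`, with the same orders: `max(0, -v(1 - a)) = max(0, -v(a))`.
[folklore] -/
theorem max_neg_ord_one_sub (v : PlaceOver K F) {a : F} (ha : a ≠ 0) (h1a : 1 - a ≠ 0) :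
    max 0 (-v.ord (1 - a)) = max 0 (-v.ord a) := by
  rcases lt_or_ge (v.ord a) 0 with h | h
  · have hlt : v.ord (-a) < v.ord (1 : F) := by rw [v.ord_neg, PlaceOver.ord_one]; exact h
    have := (v.ord_add_eq_left_of_lt (neg_ne_zero.2 ha) one_ne_zero hlt).2
    rw [neg_add_eq_sub, v.ord_neg] at this
    rw [this]
  · have haO : a ∈ v.toValuationSubring := (v.mem_toValuationSubring_iff_ord_nonneg ha).2 h
    have h1 : 0 ≤ v.ord (1 - a) :=
      (v.mem_toValuationSubring_iff_ord_nonneg h1a).1 (sub_mem (one_mem _) haO)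
    rw [max_eq_left (by omega), max_eq_left (by omega)]

omit [IsAlgFunctionField K F] [IsIntegrallyClosedIn K F] in
/-- At a place where `b` is integral, `1 - b` is integral: `v(1 - b) ≥ 0`. [folklore] -/
theorem ord_one_sub_nonneg (v : PlaceOver K F) {b : F} (hb : b ≠ 0) (h1b : 1 - b ≠ 0) (h : 0 ≤ v.ord b) :
    0 ≤ v.ord (1 - b) :=
  (v.mem_toValuationSubring_iff_ord_nonneg h1b).1
    (sub_mem (one_mem _) ((v.mem_toValuationSubring_iff_ord_nonneg hb).2 h))

end heights


/-! ### Propositions 2.1 and 2.2 of Corvaja–Zannier -/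

section prop

variable [IsAlgFunctionField K F] [IsIntegrallyClosedIn K F] [CharZero K]

omit [IsAlgFunctionField K F] [IsIntegrallyClosedIn K F] [CharZero K] in
/-- Orders of the members of the original family (`m = 0`). [cite: CorvajaZannier2007, §2 (proof of Prop. 2.1, Case (iv))] -/
theorem sum_ord_czFamily_zero (P : PlaceOver K F) {a b q : F} (ha : a ≠ 0) (hb : b ≠ 0) (hq : q ≠ 0)
    (h k : ℕ) :
    ∑ x : Fin k ⊕ (Fin (k + 1) × Fin h),
        P.ord (Sum.elim (fun i : Fin k ↦ a ^ (i : ℕ) * q)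
          (fun rs : Fin (k + 1) × Fin h ↦ a ^ (rs.1 : ℕ) * b ^ (rs.2 : ℕ)) x) =
      (∑ i : Fin k, (i : ℤ) + ∑ rs : Fin (k + 1) × Fin h, (rs.1 : ℤ)) * P.ord a + k * P.ord q +
        (∑ rs : Fin (k + 1) × Fin h, (rs.2 : ℤ)) * P.ord b := by
  have := sum_ord_czFamily P ha hb hq h k 0
  simp only [pow_zero, mul_one, Nat.cast_zero, mul_zero, zero_mul, add_zero] at this
  exact this

omit [CharZero K] in
/-- **The trivial bound** `Σ_{v ∉ S} min{v(1-a), v(1-b)} ≤ Σ_{v ∉ S} v(1-b) ≤ H(1-b) = H(b)` used in the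
proof of Cor. 2.3 ("we use the obvious inequality `Σ_{v∉S} min(v(1-a),v(1-b)) ≤ H(1-b) = H(b)`").
[cite: CorvajaZannier2007, Cor. 2.3 (proof)] -/
theorem czMin_le_finrank (hrat : ∀ P : PlaceOver K F, P.IsRational) (S : Finset (PlaceOver K F))
    {a b : F} (ha : a ∉ Set.range (algebraMap K F)) (hb : b ∉ Set.range (algebraMap K F)) :
    (∑ᶠ v : PlaceOver K F, (if v ∈ S then (0 : ℤ) else min (v.ord (1 - a)) (v.ord (1 - b)))) ≤
      Module.finrank K⟮b⟯ F := by
  have h1a : (1 : F) - a ≠ 0 := fun h0 ↦ ha ⟨1, by rw [map_one]; exact (sub_eq_zero.1 h0)⟩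
  have h1b : (1 : F) - b ≠ 0 := fun h0 ↦ hb ⟨1, by rw [map_one]; exact (sub_eq_zero.1 h0)⟩
  set T : Finset (PlaceOver K F) := S ∪ (principalDivisor K (1 - a)).support ∪
    (principalDivisor K (1 - b)).support with hT
  have hST : S ⊆ T := fun v hv ↦ by simp [hT, hv]
  have hTS : ∀ v, v ∉ T → v ∉ S := fun v hv hvS ↦ hv (hST hvS)
  have hT1a : ∀ v, v ∉ T → v.ord (1 - a) = 0 := fun v hv ↦
    PlaceOver.ord_eq_zero_of_not_mem_support h1a fun h' ↦ hv (by simp [hT, h'])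
  have hT1b : ∀ v, v ∉ T → v.ord (1 - b) = 0 := fun v hv ↦
    PlaceOver.ord_eq_zero_of_not_mem_support h1b fun h' ↦ hv (by simp [hT, h'])
  rw [finsum_eq_sum_of_support_subset _ (s := T \ S)]
  · have h5 : ∑ v ∈ T, max 0 (v.ord (1 - b)) = Module.finrank K⟮b⟯ F := by
      rw [← finsum_max_ord_sub_eq_finrank hrat hb 1, finsum_eq_sum_of_support_subset _ (s := T)]
      · refine Finset.sum_congr rfl fun v _ ↦ ?_
        rw [map_one, ← neg_sub, v.ord_neg]
      · intro v hv
        rw [Function.mem_support] at hv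
        by_contra hvT
        apply hv
        rw [map_one, ← neg_sub, v.ord_neg, hT1b v hvT, max_self]
    rw [← h5]
    refine (Finset.sum_le_sum fun v hv ↦ ?_).trans
      (Finset.sum_le_sum_of_subset_of_nonneg Finset.sdiff_subset fun v _ _ ↦ le_max_left _ _)
    have hvS := (Finset.mem_sdiff.1 hv).2
    rw [if_neg hvS]
    exact (min_le_right _ _).trans (le_max_right _ _)
  · intro v hv
    rw [Function.mem_support] at hv
    refine Finset.mem_coe.2 (Finset.mem_sdiff.2 ⟨?_, fun hvS ↦ hv (if_pos hvS)⟩)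
    by_contra hvT
    exact hv (by rw [if_neg (hTS v hvT), hT1a v hvT, hT1b v hvT, min_self])

/-- **Corvaja–Zannier 2008, Propositions 2.1–2.2** (J. Algebraic Geom. 17 (2008), §2), in the following
integral form over an algebraic function field `F/K` of characteristic `0` with all places rational and
`K` the full constant field (e.g. `K` algebraically closed). Let `S` be a finite set of places,
`a, b ∈ F ∖ K` with all their zeros and poles in `S`, and `h, k ≥ 1`, `n = hk + h + k`. Then either
`[K(a, b) : K(a)] ≤ h` (the first alternative of Prop. 2.2 for the curve with function field `K(a,b)`:
there `H(a) = [K(a,b) : K(a)]`), or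
`n · Σ_{v ∉ S} min{v(1-a), v(1-b)} ≤ (h + 2k) H(b) + k H(a) + (n(n-1)/2) χ`, where `H(y) = [F : K(y)]`
is the height (number of poles) and `χ = #S + 2g - 2` — which is the displayed inequality of Prop. 2.2
multiplied by `n = hk + h + k`. Proof as printed (Prop. 2.1 for `q = (1-a)/(1-b)` by the Wronskian of the
`n` functions `aⁱq` (`i < k`), `aʳbˢ` (`r ≤ k`, `s < h`) with respect to local parameters, the local
estimates (i)–(iv), the count `Σ_v v(ω_v) = (n(n-1)/2)(2g - 2)` by (2.2) and the product formula, and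
`H_S(q) ≤ H(b) - Σ_{v∉S} min{v(1-a), v(1-b)}` for Prop. 2.2). [cite: CorvajaZannier2007, Prop. 2.1, Prop. 2.2] -/
theorem CorvajaZannier2008_prop22 (hrat : ∀ P : PlaceOver K F, P.IsRational) (S : Finset (PlaceOver K F))
    {a b : F} (ha : a ∉ Set.range (algebraMap K F)) (hb : b ∉ Set.range (algebraMap K F))
    (hunit : ∀ v : PlaceOver K F, v ∉ S → v.ord a = 0 ∧ v.ord b = 0) {h k : ℕ} (hh : 0 < h) (hk : 0 < k) :
    (minpoly K⟮a⟯ b).natDegree ≤ h ∨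
      ((h * k + h + k : ℕ) : ℤ) *
          ∑ᶠ v : PlaceOver K F, (if v ∈ S then (0 : ℤ) else min (v.ord (1 - a)) (v.ord (1 - b))) ≤
        ((h + 2 * k : ℕ) : ℤ) * Module.finrank K⟮b⟯ F + (k : ℤ) * Module.finrank K⟮a⟯ F +
          (((h * k + h + k) * (h * k + h + k - 1) / 2 : ℕ) : ℤ) * ((S.card : ℤ) + (2 * genus K F - 2)) := by
  by_cases hdeg : (minpoly K⟮a⟯ b).natDegree ≤ h
  · exact Or.inl hdeg
  right
  push Not at hdeg
  -- basic non-vanishing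
  have hat : Transcendental K a := transcendental_of_not_mem_range ha
  have ha0 : a ≠ 0 := fun h0 ↦ ha ⟨0, by rw [h0, map_zero]⟩
  have hb0 : b ≠ 0 := fun h0 ↦ hb ⟨0, by rw [h0, map_zero]⟩
  have h1a : (1 : F) - a ≠ 0 := fun h0 ↦ ha ⟨1, by rw [map_one]; exact (sub_eq_zero.1 h0)⟩
  have h1b : (1 : F) - b ≠ 0 := fun h0 ↦ hb ⟨1, by rw [map_one]; exact (sub_eq_zero.1 h0)⟩
  set q : F := (1 - a) / (1 - b) with hq
  have hq0 : q ≠ 0 := div_ne_zero h1a h1b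
  have hqb : q * (1 - b) = 1 - a := div_mul_cancel₀ _ h1b
  -- `1, b, …, b^h` are linearly independent over `K(a)`
  have hpow : LinearIndependent K⟮a⟯ (fun s : Fin (h + 1) ↦ b ^ (s : ℕ)) :=
    (linearIndependent_pow (K := K⟮a⟯) b).comp (Fin.castLE hdeg) (Fin.castLE_injective _)
  -- the family and its Wronskian
  set n : ℕ := h * k + h + k with hn
  have hcard : Fintype.card (Fin k ⊕ (Fin (k + 1) × Fin h)) = n := card_czIndex h k
  set e : (Fin k ⊕ (Fin (k + 1) × Fin h)) ≃ Fin n := Fintype.equivFinOfCardEq hcard with he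
  set f : (Fin k ⊕ (Fin (k + 1) × Fin h)) → F :=
    Sum.elim (fun i : Fin k ↦ a ^ (i : ℕ) * q) (fun rs : Fin (k + 1) × Fin h ↦ a ^ (rs.1 : ℕ) * b ^ (rs.2 : ℕ))
    with hf
  have hf0 : ∀ x, f x ≠ 0 := by
    rintro (i | ⟨r, s⟩)
    · exact mul_ne_zero (pow_ne_zero _ ha0) hq0
    · exact mul_ne_zero (pow_ne_zero _ ha0) (pow_ne_zero _ hb0)
  have hfind : LinearIndependent K f := linearIndependent_czFamily hat hqb hh hpow
  have hfe : LinearIndependent K (f ∘ e.symm) := hfind.comp _ e.symm.injective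
  set ω : F := wronskian K a (f ∘ e.symm) with hω
  have hω0 : ω ≠ 0 := wronskian_ne_zero_of_linearIndependent hrat ha hfe
  set N : ℕ := n * (n - 1) / 2 with hN
  -- the local Wronskians `ω_v = W_{t_v}(f)` and their orders
  have hda : dOf K a ≠ 0 := dOf_ne_zero hrat ha
  have hu0 : ∀ v : PlaceOver K F, tderiv K (v.uniformizer : F) a ≠ 0 := fun v ↦
    tderiv_ne_zero hrat v.uniformizer_not_mem_range ha
  have hWv : ∀ v : PlaceOver K F,
      wronskian K (v.uniformizer : F) (f ∘ e.symm) = tderiv K (v.uniformizer : F) a ^ N * ω := fun v ↦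
    wronskian_eq_pow_mul_wronskian (dOf_ne_zero hrat v.uniformizer_not_mem_range) hda _
  have hWv0 : ∀ v : PlaceOver K F, wronskian K (v.uniformizer : F) (f ∘ e.symm) ≠ 0 := fun v ↦ by
    rw [hWv]; exact mul_ne_zero (pow_ne_zero _ (hu0 v)) hω0
  have hordWv : ∀ v : PlaceOver K F,
      v.ord (wronskian K (v.uniformizer : F) (f ∘ e.symm)) = N * v.diffOrd a + v.ord ω := fun v ↦ by
    rw [hWv, v.ord_mul_eq (pow_ne_zero _ (hu0 v)) hω0, v.ord_pow (hu0 v), ord_tderiv_uniformizer hrat v ha]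
  -- Cases (i)–(ii): places outside `S`
  have hLB1 : ∀ v : PlaceOver K F, v ∉ S → (n : ℤ) * min 0 (v.ord q) ≤ N * v.diffOrd a + v.ord ω := by
    intro v hv
    rw [← hordWv]
    obtain ⟨hva, hvb⟩ := hunit v hv
    have haO : a ∈ v.toValuationSubring := (v.mem_toValuationSubring_iff_ord_nonneg ha0).2 hva.ge
    have hbO : b ∈ v.toValuationSubring := (v.mem_toValuationSubring_iff_ord_nonneg hb0).2 hvb.ge
    rcases le_or_gt (v.ord q) 0 with hq' | hq'
    · rw [min_eq_right hq']
      have hqi : q⁻¹ ∈ v.toValuationSubring :=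
        (v.mem_toValuationSubring_iff_ord_nonneg (inv_ne_zero hq0)).2 (by rw [v.ord_inv hq0]; omega)
      refine mul_ord_le_ord_wronskian_uniformizer hrat v hq0 (fun j ↦ ?_) (hWv0 v)
      rw [Function.comp_apply]
      rcases e.symm j with i | ⟨r, s⟩
      · simp only [hf, Sum.elim_inl]
        rw [mul_comm, mul_assoc, mul_inv_cancel₀ hq0, mul_one]
        exact pow_mem haO _
      · simp only [hf, Sum.elim_inr]
        exact mul_mem hqi (mul_mem (pow_mem haO _) (pow_mem hbO _))
    · rw [min_eq_left hq'.le, mul_zero]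
      have hqO : q ∈ v.toValuationSubring := (v.mem_toValuationSubring_iff_ord_nonneg hq0).2 hq'.le
      have := mul_ord_le_ord_wronskian_uniformizer hrat v one_ne_zero (q := 1) (f := f ∘ e.symm)
        (fun j ↦ by
          rw [inv_one, one_mul, Function.comp_apply]
          rcases e.symm j with i | ⟨r, s⟩
          · simp only [hf, Sum.elim_inl]; exact mul_mem (pow_mem haO _) hqO
          · simp only [hf, Sum.elim_inr]; exact mul_mem (pow_mem haO _) (pow_mem hbO _)) (hWv0 v)
      simpa [PlaceOver.ord_one] using this
  -- Cases (iii)–(iv): all places (used on `S`)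
  set A : ℤ := ∑ i : Fin k, (i : ℤ) + ∑ rs : Fin (k + 1) × Fin h, (rs.1 : ℤ) with hA
  set C : ℤ := ∑ rs : Fin (k + 1) × Fin h, (rs.2 : ℤ) with hC
  have hLB2 : ∀ v : PlaceOver K F,
      A * v.ord a + k * v.ord q + C * v.ord b + k * h * max 0 (v.ord b) - N ≤ N * v.diffOrd a + v.ord ω := by
    intro v
    rw [← hordWv]
    rcases le_or_gt (v.ord b) 0 with hvb | hvb
    · rw [max_eq_left hvb, mul_zero, add_zero, ← sum_ord_czFamily_zero v ha0 hb0 hq0 h k]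
      exact sum_ord_sub_le_ord_wronskian_uniformizer_equiv hrat v e hf0 (hWv0 v)
    · rw [max_eq_right hvb.le, hf, ← wronskian_czFamily_eq _ hqb h k e]
      have hf'0 : ∀ x, Sum.elim (fun i : Fin k ↦ a ^ (i : ℕ) * b ^ h * q)
          (fun rs : Fin (k + 1) × Fin h ↦ a ^ (rs.1 : ℕ) * b ^ (rs.2 : ℕ)) x ≠ 0 := by
        rintro (i | ⟨r, s⟩)
        · exact mul_ne_zero (mul_ne_zero (pow_ne_zero _ ha0) (pow_ne_zero _ hb0)) hq0
        · exact mul_ne_zero (pow_ne_zero _ ha0) (pow_ne_zero _ hb0)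
      have hW'0 : wronskian K (v.uniformizer : F) (Sum.elim (fun i : Fin k ↦ a ^ (i : ℕ) * b ^ h * q)
          (fun rs : Fin (k + 1) × Fin h ↦ a ^ (rs.1 : ℕ) * b ^ (rs.2 : ℕ)) ∘ e.symm) ≠ 0 := by
        rw [wronskian_czFamily_eq _ hqb h k e, ← hf]; exact hWv0 v
      have h1 := sum_ord_sub_le_ord_wronskian_uniformizer_equiv hrat v e hf'0 hW'0
      rw [sum_ord_czFamily v ha0 hb0 hq0 h k h] at h1
      push_cast at h1 ⊢
      linarith
  -- a finite set of places carrying everything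
  set T : Finset (PlaceOver K F) := S ∪ (principalDivisor K ω).support ∪ (principalDivisor K q).support ∪
    (principalDivisor K (1 - b)).support ∪ (differentialDivisor (dOf K a)).support with hT
  have hST : S ⊆ T := by
    intro v hv; simp only [hT, Finset.mem_union]; exact Or.inl (Or.inl (Or.inl (Or.inl hv)))
  have hTω : ∀ v, v ∉ T → v.ord ω = 0 := fun v hv ↦
    PlaceOver.ord_eq_zero_of_not_mem_support hω0 fun h' ↦ hv (by simp [hT, h'])
  have hTq : ∀ v, v ∉ T → v.ord q = 0 := fun v hv ↦
    PlaceOver.ord_eq_zero_of_not_mem_support hq0 fun h' ↦ hv (by simp [hT, h'])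
  have hT1b : ∀ v, v ∉ T → v.ord (1 - b) = 0 := fun v hv ↦
    PlaceOver.ord_eq_zero_of_not_mem_support h1b fun h' ↦ hv (by simp [hT, h'])
  have hTδ : ∀ v, v ∉ T → v.diffOrd a = 0 := fun v hv ↦ by
    rw [← differentialDivisor_dOf_apply hrat ha v]
    by_contra h'
    exact hv (by simp [hT, Finsupp.mem_support_iff.2 h'])
  have hTS : ∀ v, v ∉ T → v ∉ S := fun v hv hvS ↦ hv (hST hvS)
  -- global identities
  have hsumδ : ∑ v ∈ T, v.diffOrd a = 2 * genus K F - 2 := by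
    rw [← finsum_diffOrd_eq hrat ha, finsum_eq_sum_of_support_subset _ (s := T)]
    intro v hv; by_contra h'; exact hv (hTδ v h')
  have hsumω : ∑ v ∈ T, v.ord ω = 0 := by
    rw [← finsum_ord_eq_zero hrat hω0, finsum_eq_sum_of_support_subset _ (s := T)]
    intro v hv; by_contra h'; exact hv (hTω v h')
  have hsuma : ∑ v ∈ S, v.ord a = 0 := by
    rw [← finsum_ord_eq_zero hrat ha0, finsum_eq_sum_of_support_subset _ (s := S)]
    intro v hv; by_contra h'; exact hv (hunit v h').1
  have hsumb : ∑ v ∈ S, v.ord b = 0 := by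
    rw [← finsum_ord_eq_zero hrat hb0, finsum_eq_sum_of_support_subset _ (s := S)]
    intro v hv; by_contra h'; exact hv (hunit v h').2
  have hHb : ∑ v ∈ S, max 0 (v.ord b) = (Module.finrank K⟮b⟯ F : ℤ) := by
    rw [← finsum_max_ord_sub_eq_finrank hrat hb 0, map_zero, sub_zero,
      finsum_eq_sum_of_support_subset _ (s := S)]
    intro v hv; by_contra h'; rw [Function.mem_support, (hunit v h').2] at hv; exact hv rfl
  -- summing the local estimates: (2.4)–(2.5)
  set Mq : ℤ := ∑ᶠ v : PlaceOver K F, (if v ∈ S then (0 : ℤ) else min 0 (v.ord q)) with hMq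
  have hMqT : Mq = ∑ v ∈ T \ S, min 0 (v.ord q) := by
    rw [hMq, finsum_eq_sum_of_support_subset _ (s := T \ S)]
    · refine Finset.sum_congr rfl fun v hv ↦ ?_
      rw [if_neg (Finset.mem_sdiff.1 hv).2]
    · intro v hv
      rw [Function.mem_support] at hv
      refine Finset.mem_coe.2 (Finset.mem_sdiff.2 ⟨?_, fun hvS ↦ hv (if_pos hvS)⟩)
      by_contra hvT
      exact hv (by rw [if_neg (hTS v hvT), hTq v hvT, min_self])
  have hstar : (N : ℤ) * (2 * genus K F - 2) ≥
      k * ∑ v ∈ S, v.ord q + k * h * Module.finrank K⟮b⟯ F - N * S.card + n * Mq := by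
    have hsplit : ∑ v ∈ T, ((N : ℤ) * v.diffOrd a + v.ord ω) =
        ∑ v ∈ T \ S, ((N : ℤ) * v.diffOrd a + v.ord ω) + ∑ v ∈ S, ((N : ℤ) * v.diffOrd a + v.ord ω) :=
      (Finset.sum_sdiff hST).symm
    have hlhs : ∑ v ∈ T, ((N : ℤ) * v.diffOrd a + v.ord ω) = N * (2 * genus K F - 2) := by
      rw [Finset.sum_add_distrib, ← Finset.mul_sum, hsumδ, hsumω, add_zero]
    have h1 : ∑ v ∈ T \ S, (n : ℤ) * min 0 (v.ord q) ≤ ∑ v ∈ T \ S, ((N : ℤ) * v.diffOrd a + v.ord ω) :=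
      Finset.sum_le_sum fun v hv ↦ hLB1 v (Finset.mem_sdiff.1 hv).2
    have h2 : ∑ v ∈ S, (A * v.ord a + k * v.ord q + C * v.ord b + k * h * max 0 (v.ord b) - N) ≤
        ∑ v ∈ S, ((N : ℤ) * v.diffOrd a + v.ord ω) :=
      Finset.sum_le_sum fun v _ ↦ hLB2 v
    have h2' : ∑ v ∈ S, (A * v.ord a + k * v.ord q + C * v.ord b + k * h * max 0 (v.ord b) - N) =
        k * ∑ v ∈ S, v.ord q + k * h * Module.finrank K⟮b⟯ F - N * S.card := by
      simp only [Finset.sum_add_distrib, Finset.sum_sub_distrib, ← Finset.mul_sum, hsuma, hsumb, hHb,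
        Finset.sum_const, nsmul_eq_mul, mul_zero, zero_add, add_zero]
      ring
    have h1' : ∑ v ∈ T \ S, (n : ℤ) * min 0 (v.ord q) = n * Mq := by
      rw [hMqT, ← Finset.mul_sum]
    rw [ge_iff_le, ← hlhs, hsplit, ← h1', ← h2']
    linarith
  -- `-Σ_{v ∈ S} v(q) ≤ H(q) ≤ H(a) + H(b)`
  have hSq : -∑ v ∈ S, v.ord q ≤ (Module.finrank K⟮a⟯ F : ℤ) + Module.finrank K⟮b⟯ F := by
    have h1 : -∑ v ∈ S, v.ord q ≤ ∑ v ∈ T, max 0 (-v.ord q) := by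
      rw [← Finset.sum_neg_distrib]
      exact (Finset.sum_le_sum fun v _ ↦ le_max_right 0 (-v.ord q)).trans
        (Finset.sum_le_sum_of_subset_of_nonneg hST fun v _ _ ↦ le_max_left _ _)
    have h2 : ∀ v : PlaceOver K F, max 0 (-v.ord q) ≤ max 0 (-v.ord (1 - a)) + max 0 (v.ord (1 - b)) := by
      intro v
      rw [hq, v.ord_div h1a h1b]
      omega
    have h3 : ∑ v ∈ T, max 0 (-v.ord q) ≤ ∑ v ∈ T, max 0 (-v.ord (1 - a)) + ∑ v ∈ T, max 0 (v.ord (1 - b)) := by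
      rw [← Finset.sum_add_distrib]; exact Finset.sum_le_sum fun v _ ↦ h2 v
    have h4 : ∑ v ∈ T, max 0 (-v.ord (1 - a)) = Module.finrank K⟮a⟯ F := by
      rw [← finsum_max_neg_ord_eq_finrank hrat ha, finsum_eq_sum_of_support_subset _ (s := T)]
      · exact Finset.sum_congr rfl fun v _ ↦ max_neg_ord_one_sub v ha0 h1a
      · intro v hv
        rw [Function.mem_support] at hv
        by_contra hvT
        exact hv (by rw [(hunit v (hTS v hvT)).1, neg_zero, max_self])
    have h5 : ∑ v ∈ T, max 0 (v.ord (1 - b)) = Module.finrank K⟮b⟯ F := by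
      rw [← finsum_max_ord_sub_eq_finrank hrat hb 1, finsum_eq_sum_of_support_subset _ (s := T)]
      · refine Finset.sum_congr rfl fun v _ ↦ ?_
        rw [map_one, ← neg_sub, v.ord_neg]
      · intro v hv
        rw [Function.mem_support] at hv
        by_contra hvT
        apply hv
        rw [map_one, ← neg_sub, v.ord_neg, hT1b v hvT, max_self]
    linarith
  -- Prop. 2.2: `H_S(q) ≤ H(b) - Σ_{v ∉ S} min(v(1-a), v(1-b))`
  set Msum : ℤ := ∑ᶠ v : PlaceOver K F, (if v ∈ S then (0 : ℤ) else min (v.ord (1 - a)) (v.ord (1 - b)))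
    with hMsum
  have hE : -Mq ≤ Module.finrank K⟮b⟯ F - Msum := by
    -- pointwise, off `S`: `-min(0, v(q)) = v(1-b) - min(v(1-a), v(1-b))`
    have hpt : ∀ v : PlaceOver K F, v ∉ S →
        -min 0 (v.ord q) = v.ord (1 - b) - min (v.ord (1 - a)) (v.ord (1 - b)) := by
      intro v hv
      rw [hq, v.ord_div h1a h1b]
      omega
    have hMsumT : Msum = ∑ v ∈ T \ S, min (v.ord (1 - a)) (v.ord (1 - b)) := by
      rw [hMsum, finsum_eq_sum_of_support_subset _ (s := T \ S)]
      · exact Finset.sum_congr rfl fun v hv ↦ by rw [if_neg (Finset.mem_sdiff.1 hv).2]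
      · intro v hv
        rw [Function.mem_support] at hv
        refine Finset.mem_coe.2 (Finset.mem_sdiff.2 ⟨?_, fun hvS ↦ hv (if_pos hvS)⟩)
        by_contra hvT
        apply hv
        rw [if_neg (hTS v hvT), hT1b v hvT]
        have h0 := hpt v (hTS v hvT)
        rw [hTq v hvT, hT1b v hvT, min_self] at h0
        omega
    have h1 : -Mq = ∑ v ∈ T \ S, v.ord (1 - b) - Msum := by
      rw [hMqT, hMsumT, ← Finset.sum_neg_distrib, ← Finset.sum_sub_distrib]
      exact Finset.sum_congr rfl fun v hv ↦ hpt v (Finset.mem_sdiff.1 hv).2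
    have h2 : ∑ v ∈ T \ S, v.ord (1 - b) ≤ ∑ v ∈ T, max 0 (v.ord (1 - b)) := by
      refine (Finset.sum_le_sum fun v hv ↦ ?_).trans
        (Finset.sum_le_sum_of_subset_of_nonneg Finset.sdiff_subset fun v _ _ ↦ le_max_left _ _)
      have hvS := (Finset.mem_sdiff.1 hv).2
      exact (max_eq_right (ord_one_sub_nonneg v hb0 h1b (hunit v hvS).2.ge)).ge
    have h5 : ∑ v ∈ T, max 0 (v.ord (1 - b)) = Module.finrank K⟮b⟯ F := by
      rw [← finsum_max_ord_sub_eq_finrank hrat hb 1, finsum_eq_sum_of_support_subset _ (s := T)]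
      · refine Finset.sum_congr rfl fun v _ ↦ ?_
        rw [map_one, ← neg_sub, v.ord_neg]
      · intro v hv
        rw [Function.mem_support] at hv
        by_contra hvT
        apply hv
        rw [map_one, ← neg_sub, v.ord_neg, hT1b v hvT, max_self]
    linarith
  -- conclusion
  have hk0 : (0 : ℤ) ≤ k := by positivity
  have hn0 : (0 : ℤ) ≤ n := by positivity
  have i1 := mul_le_mul_of_nonneg_left hSq hk0
  have i2 := mul_le_mul_of_nonneg_left hE hn0
  have hn' : (n : ℤ) = h * k + h + k := by rw [hn]; push_cast; ring
  have e1 : (n : ℤ) * Module.finrank K⟮b⟯ F =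
      h * k * Module.finrank K⟮b⟯ F + h * Module.finrank K⟮b⟯ F + k * Module.finrank K⟮b⟯ F := by
    rw [hn']; ring
  push_cast
  linarith [hstar, i1, i2, e1]

end prop

end Literature.NumberTheory.DiophantineGeometry.AlgFunctionField
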